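import Literature.AlgebraicGeometry.HodgeTheory.BettiHodgeConjectureSquareAlgebraicCorrespondences
import Literature.AlgebraicGeometry.HodgeTheory.CrossProductTopClass
import Literature.AlgebraicGeometry.HodgeTheory.RationalClassesIndependent
import HarnessLib

/-!
# Lemma 11.41 is injective on the lane's carriers: a correspondence of the Künneth piece `Hⁱ(Y) ⊗ Hʲ(Z)` is determined by its action `H^{2n−j}(Z;ℂ) → Hⁱ(Y;ℂ)`; the exact formula
# `(pr_Y^* y ∪ pr_Z^* w)_* u = (−1)^{a i} y ∪ pr_{Y*} pr_Z^*(u ∪ w)`; ℚ-independent classes act ℂ-independently; the bound `|ι| ≤ dim_ℚ Hdgᶜ(HⁱY ⊗ HʲZ)` is attained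
# (Voisin I §11.3.3 p. 286, Lemma 11.41; Voisin II (10.7); Fulton, Young Tableaux App. B (5)–(6); Hatcher Prop. 3.38, Thm. 3.15)

Family `hodge`, lane `lit-hodgefound` (Track 2 foundations library; Layers A1/A4), layer `Literature/AlgebraicGeometry/HodgeTheory`.  THEOREMS ONLY (no definition, no named fact, no instance;
D-0026 net debt `0`).  Voisin proves Lemma 11.41 through the identification «`Hᵏ(X) ⊗ Hˡ(Y) ≅ Hom(H^{2n−k}(X), Hˡ(Y))` given by Poincaré duality» (p. 286): a class of the Künneth piece IS the
morphism it induces.  On the lane's carriers the action of `γ ∈ H^{2c}((Y ⊗ Z)(ℂ); ℂ)` is the tree's `corrAction μ hY hZ hab γ : Hᵃ(Z;ℂ) → Hⁱ(Y;ℂ)`, `γ_*(u) = pr_{Y*}(pr_Z^* u ∪ γ)` (`a + 2c = i + 2n`,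
Voisin II (10.7); the FIRST factor receives), and the seat's g29-#4 / g30-#1 used only that the OTHER pieces act by zero and that `(pr_Y^* y ∪ pr_Z^* w)_* u ∈ ℂ·y`.  This file proves the
missing half: **the action is INJECTIVE on the piece `Hⁱ(Y) ⊗ Hʲ(Z)`, `j = 2n − a`** — so a correspondence supported in one Künneth piece is determined by its action, ℚ-linearly independent
classes of `Hⁱ(Y;ℚ) ⊗ Hʲ(Z;ℚ)` act ℂ-linearly independently, the Künneth component with a prescribed action (g30-#1 §1/§3) is unique, and the lower bound `|ι| ≤ dim_ℚ Hdgᶜ(HⁱY ⊗ HʲZ)` of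
g30-#1 §2 is attained by the cross products of a basis of `Hdgᶜ(HⁱY ⊗ HʲZ)`.

THE ARGUMENT (Poincaré duality twice).  (1) `(pr_Y^* y ∪ pr_Z^* w)_* u = (−1)^{a i} · y ∪ pr_{Y*} pr_Z^*(u ∪ w)` (graded commutativity, naturality of `pr_Z^*`, projection formula for `pr_{Y*}`,
Fulton (5)–(6)).  (2) `pr_{Y*} pr_Z^* : H^{2n}(Z;ℂ) → H⁰(Y;ℂ) = ℂ·1` kills no non-zero class (the tree's `complexGysin_fst_map_snd_ne_zero_of_ne_zero`: Künneth in the top degree and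
`[(Y ⊗ Z)(ℂ)] ≠ 0`).  (3) Write a class of the piece as `Σ_p pr_Y^* b_p ∪ pr_Z^* w_p` over the ℂ-basis `b_p = β_p ⊗ 1` of `Hⁱ(Y;ℂ)` induced by a ℚ-basis `β_p` of `Hⁱ(Y;ℚ)` (`Hⁱ(Y;ℚ) ⊗ ℂ = Hⁱ(Y;ℂ)`,
Voisin I §7.1.1; the tree's `span_isRationalClass_eq_top_of_isSmoothProjective_holds`, `linearIndependent_of_isRationalClass`); if it acts by zero then, by (1) and the independence of the
`b_p`, `pr_{Y*} pr_Z^*(u ∪ w_p) = 0` for all `u`, `p`, so `u ∪ w_p = 0` for all `u` by (2), so `w_p = 0` by Poincaré duality on `Z(ℂ)` (Hatcher Prop. 3.38; the tree's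
`eq_zero_of_forall_cupPairing_eq_zero`), and the class is zero.

WHAT IS PROVED.
* §1 **`corrAction_cupProduct_fst_snd_eq`** (any orientation family `μ`): the exact formula (1); **`corrAction_sum_cupProduct_fst_snd_apply`** (summed form).
* §2 **`corrAction_injOn_kunnethPiece`**: `γ ∈ kunnethPiece Y Z (i + j = 2c)`, `a + j = 2n`, `(γ)_* = 0` on `Hᵃ(Z;ℂ)` ⇒ `γ = 0`; **`eq_of_mem_kunnethPiece_of_corrAction_eq`**.
* §3 THE ℚ-SUMMAND `Hⁱ(Y;ℚ) ⊗ Hʲ(Z;ℚ)`: **`BettiUniverse.eq_zero_of_corrAction_crossMap_eq_zero`**, **`BettiUniverse.corrAction_crossMap_injective`** (`t ↦ (crossMap t ⊗ 1)_*` is injective),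
  **`BettiUniverse.linearIndependent_corrAction_crossMap`** (ℚ-independent `t_k` ⇒ ℂ-independent actions), **`BettiUniverse.existsUnique_kunneth_component_corrAction_eq`** (the Künneth
  component of a Hodge class acting as the class, g30-#1 §1, is unique and is a Hodge class), **`BettiUniverse.exists_hodgeClasses_linearIndependent_corrAction`** (`dim_ℚ Hdgᶜ(HⁱY ⊗ HʲZ)` Hodge
  classes on `Y × Z` with ℂ-independent actions: the bound of g30-#1 §2 is attained) and the resulting **`BettiUniverse.finrank_hodgeClasses_tensor_eq_card_iff…`**-type equality
  **`BettiUniverse.exists_card_eq_finrank_hodgeClasses_tensor_linearIndependent_corrAction`**.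

THE PRINTS.  C. Voisin (2002) [VoisinHodgeI2002] §7.1.1; §11.3.3 Thm. 11.38, Thm. 11.40, Lemma 11.41 and its proof, p. 286.  C. Voisin (2003) [VoisinHodgeII2003] §10.2.2 proof of Thm. 10.17, (10.7).
W. Fulton (1997) [FultonYoungTableaux1997] Appendix B §B.1 (5)–(6) (Gysin maps, projection formula).  A. Hatcher (2002) [HatcherAT2002] §3.2 Thm. 3.15 (Künneth), §3.3 Prop. 3.38 (the cup product
pairing is perfect over a field).  C. Voisin (2025) [Voisin2025] §3.2.1 (12)–(14).

THE OBJECTS (all the tree's).  `Y Z : SchemeOver ℂ`, `hY : IsSmoothProjective m Y`, `hZ : IsSmoothProjective n Z`; `complexBetti`, `complexBetti.map` (pull-backs), `cupProduct`, `complexGysin μ` (Gysin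
maps of an orientation family), `corrAction μ hY hZ hab`, `kunnethPiece Y Z h ⊂ H^{2c}((Y ⊗ Z)(ℂ); ℂ)`; `bettiCohomology`, `ofRatClass`, `IsRationalClass`, `BettiUniverse.crossMap`,
`BettiUniverse.kunnethMap`, `BettiUniverse.kunnethSummand`, `BettiUniverse.hodge hHD hX k` and its `hodgeClasses`, `HodgeStructure.tensor`.

DEVIATIONS / SCOPE.  Only injectivity is proved, not the surjectivity half of «`≅ Hom(H^{2n−k}(X), Hˡ(Y))`» (a dimension count the lane does not need).  No definitions.

## References
* [VoisinHodgeI2002] C. Voisin, *Hodge Theory and Complex Algebraic Geometry I* (2002) — §7.1.1; §11.3.3 Thm. 11.38, Thm. 11.40, Lemma 11.41, p. 286.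
* [VoisinHodgeII2003] C. Voisin, *Hodge Theory and Complex Algebraic Geometry II* (2003) — §10.2.2 proof of Thm. 10.17 (10.7).
* [FultonYoungTableaux1997] W. Fulton, *Young Tableaux* (1997) — Appendix B §B.1 (5)–(6).
* [HatcherAT2002] A. Hatcher, *Algebraic Topology* (2002) — §3.1 p. 198; §3.2 Thm. 3.15; §3.3 Prop. 3.38.
* [Voisin2025] C. Voisin, *Cycle classes on algebraic varieties* (2025) — §3.2.1 (12)–(14).

## Provenance
Lane `lit-hodgefound` (Hodge path, Track 2), prover seat `lit-hodgefound-p29` (generation 30), self-proposed row g30-#2 (the injectivity asked for by gen-29 free pointer (a)).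
-/

noncomputable section

open scoped TensorProduct
open CategoryTheory MonoidalCategory CartesianMonoidalCategory Module Finset
open Literature.AlgebraicTopology.SingularHomology
open Literature.Geometry.Kaehler

namespace Literature.AlgebraicGeometry.HodgeTheory

open Literature.AlgebraicGeometry.Motives
open Literature.AlgebraicGeometry.Motives.HodgeStructure

variable {m n d : ℕ} {X Y Z : SchemeOver ℂ}

/-! ### §0 Plumbing -/

/-- `(q • a) ⊗ 1 = q • (a ⊗ 1)` for the lattice map `Hᵏ(Y;ℚ) → Hᵏ(Y;ℂ)` (private copy of the tree's file-local lemma). [cite: HatcherAT2002, §3.1 p. 198] -/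
private theorem ofRatClass_rat_smul' {T : Type} [TopologicalSpace T] {k : ℕ} (q : ℚ) (a : singularCohomology ℚ ℚ T k) :
    ofRatClass T k (q • a) = (q : ℂ) • ofRatClass T k a := by
  rw [ofRatClass, coeffClass_smul, smul_coeffClass]
  refine coeffClass_congr (fun x ↦ ?_) a
  simp

/-! ### §1 The exact formula `(pr_Y^* y ∪ pr_Z^* w)_* u = (−1)^{a i} · y ∪ pr_{Y*} pr_Z^*(u ∪ w)` -/

section Formula

variable (μ : OrientationFamily)

/-- **`(pr_Y^* y ∪ pr_Z^* w)_* u = (−1)^{a·i} · y ∪ pr_{Y*} pr_Z^*(u ∪ w)`** for `y ∈ Hⁱ(Y;ℂ)`, `w ∈ Hʲ(Z;ℂ)`, `u ∈ Hᵃ(Z;ℂ)`, `a + j = 2 dim Z` (so `u ∪ w` is a top class of `Z(ℂ)`), every orientation family `μ`: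
`pr_{Y*}(pr_Z^* u ∪ pr_Y^* y ∪ pr_Z^* w) = (−1)^{a i} pr_{Y*}(pr_Y^* y ∪ pr_Z^*(u ∪ w)) = (−1)^{a i} y ∪ pr_{Y*} pr_Z^*(u ∪ w)` (graded commutativity, naturality of `pr_Z^*`, projection formula for `pr_{Y*}`).
(For `a + j ≠ 2 dim Z` the action is `0`: the tree's `corrAction_cupProduct_fst_snd_eq_zero_of_ne`.) [cite: VoisinHodgeI2002, §11.3.3 p. 286] [cite: VoisinHodgeII2003, §10.2.2 proof of Thm. 10.17 (10.7)]
[cite: FultonYoungTableaux1997, Appendix B §B.1 (5)–(6)] -/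
theorem corrAction_cupProduct_fst_snd_eq (hY : IsSmoothProjective m Y) (hZ : IsSmoothProjective n Z) {c i j a : ℕ} (hij : i + j = 2 * c) (haj : a + j = 2 * n) (hab : a + 2 * c = i + 2 * n)
    (y : complexBetti Y i) (w : complexBetti Z j) (u : complexBetti Z a) :
    corrAction μ hY hZ hab (cupProduct hij (complexBetti.map (fst Y Z) i y) (complexBetti.map (snd Y Z) j w)) u =
      ((-1 : ℂ) ^ (a * i)) • cupProduct (Nat.add_zero i) y
        (complexGysin μ (hY.tensor_holds hZ) hY (fst Y Z) (show 2 * n + 2 * m = 0 + 2 * (m + n) by omega) (complexBetti.map (snd Y Z) (2 * n) (cupProduct haj u w))) := by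
  have hμ : μ.HasPoincareDuality := OrientationFamily.hasPoincareDuality μ
  have hYZ := hY.tensor_holds hZ
  rw [corrAction_apply,
    ← cupProduct_assoc (rfl : a + i = a + i) hij (show a + i + j = a + 2 * c by omega) (rfl : a + 2 * c = a + 2 * c),
    cupProduct_gradedComm_holds ℂ _ (rfl : a + i = a + i) (show i + a = a + i by omega) (complexBetti.map (snd Y Z) a u) (complexBetti.map (fst Y Z) i y),
    map_smul, LinearMap.smul_apply,
    cupProduct_assoc (show i + a = a + i by omega) haj (show a + i + j = a + 2 * c by omega) (show i + 2 * n = a + 2 * c by omega),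
    ← cupProduct_map, map_smul,
    complexGysin_cup hμ hYZ hY (fst Y Z) (show i + 2 * n = a + 2 * c by omega) (corrAction_degree m hab) (show 2 * n + 2 * m = 0 + 2 * (m + n) by omega) (Nat.add_zero i) y _]

/-- **Summed form**: `(Σ_p pr_Y^* b_p ∪ pr_Z^* w_p)_* u = Σ_p (−1)^{a i} · b_p ∪ pr_{Y*} pr_Z^*(u ∪ w_p)`. [cite: VoisinHodgeI2002, §11.3.3 p. 286] [cite: FultonYoungTableaux1997, Appendix B §B.1 (5)–(6)] -/
theorem corrAction_sum_cupProduct_fst_snd_apply {ι : Type} [Fintype ι] (hY : IsSmoothProjective m Y) (hZ : IsSmoothProjective n Z) {c i j a : ℕ} (hij : i + j = 2 * c) (haj : a + j = 2 * n)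
    (hab : a + 2 * c = i + 2 * n) (b : ι → complexBetti Y i) (w : ι → complexBetti Z j) (u : complexBetti Z a) :
    corrAction μ hY hZ hab (∑ p, cupProduct hij (complexBetti.map (fst Y Z) i (b p)) (complexBetti.map (snd Y Z) j (w p))) u =
      ∑ p, ((-1 : ℂ) ^ (a * i)) • cupProduct (Nat.add_zero i) (b p)
        (complexGysin μ (hY.tensor_holds hZ) hY (fst Y Z) (show 2 * n + 2 * m = 0 + 2 * (m + n) by omega) (complexBetti.map (snd Y Z) (2 * n) (cupProduct haj u (w p)))) := by
  rw [map_sum, LinearMap.sum_apply]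
  exact Finset.sum_congr rfl fun p _ ↦ corrAction_cupProduct_fst_snd_eq μ hY hZ hij haj hab (b p) (w p) u

end Formula

/-! ### §2 The action is injective on a Künneth piece -/

section Injective

variable (μ : OrientationFamily)

/-- `pr_{Y*} pr_Z^*` kills no non-zero top class of `Z(ℂ)` (contrapositive of the tree's `complexGysin_fst_map_snd_ne_zero_of_ne_zero`). [cite: HatcherAT2002, §3.2 Thm. 3.15] [cite: FultonYoungTableaux1997, Appendix B §B.1 (5)] -/
theorem eq_zero_of_complexGysin_fst_map_snd_eq_zero (hY : IsSmoothProjective m Y) (hZ : IsSmoothProjective n Z) {x : complexBetti Z (2 * n)}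
    (hx : complexGysin μ (hY.tensor_holds hZ) hY (fst Y Z) (show 2 * n + 2 * m = 0 + 2 * (m + n) by omega) (complexBetti.map (snd Y Z) (2 * n) x) = 0) : x = 0 := by
  by_contra h
  exact complexGysin_fst_map_snd_ne_zero_of_ne_zero μ hY hZ h hx

/-- **Poincaré duality on `Z(ℂ)`, right slot**: `w ∈ Hʲ(Z;ℂ)` with `u ∪ w = 0` for every `u ∈ Hᵃ(Z;ℂ)`, `a + j = 2 dim Z`, is zero (the cup product pairing is perfect over `ℂ`; graded commutativity
moves `w` to the left slot of the tree's `eq_zero_of_forall_cupPairing_eq_zero`). [cite: HatcherAT2002, §3.3 Prop. 3.38] -/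
theorem eq_zero_of_forall_cupProduct_eq_zero_right (hZ : IsSmoothProjective n Z) {j a : ℕ} (haj : a + j = 2 * n) {w : complexBetti Z j}
    (hw : ∀ u : complexBetti Z a, cupProduct haj u w = 0) : w = 0 := by
  refine eq_zero_of_forall_cupPairing_eq_zero complexOrientationFamily hZ (show j + a = 2 * n by omega) fun u ↦ ?_
  rw [cupPairing_apply, cupProduct_gradedComm_holds ℂ _ (show j + a = 2 * n by omega) haj w u, hw u, smul_zero, map_zero, LinearMap.zero_apply]

/-- The `ℂ`-span of a `ℚ`-basis of `Hⁱ(Y;ℚ)`, pushed to `Hⁱ(Y;ℂ)`, is everything (`Hⁱ(Y;ℚ) ⊗ ℂ = Hⁱ(Y;ℂ)`: rational classes span, the tree's `span_isRationalClass_eq_top_of_isSmoothProjective_holds`).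
[cite: VoisinHodgeI2002, §7.1.1] -/
theorem mem_span_range_ofRatClass_basis {ι : Type} [Fintype ι] (hY : IsSmoothProjective m Y) {i : ℕ} (β : Module.Basis ι ℚ (bettiCohomology Y i)) (y : complexBetti Y i) :
    y ∈ Submodule.span ℂ (Set.range fun p ↦ ofRatClass (ComplexPoints Y) i (β p)) := by
  have htop := span_isRationalClass_eq_top_of_isSmoothProjective_holds m Y hY i
  have hy : y ∈ Submodule.span ℂ {c : complexBetti Y i | IsRationalClass c} := by
    rw [htop]
    exact Submodule.mem_top
  refine (Submodule.span_le.2 ?_) hy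
  intro c hc
  obtain ⟨x, rfl⟩ := (isRationalClass_iff_mem_range_ofRatClass _).1 hc
  rw [← β.sum_repr x]
  simp only [SetLike.mem_coe, map_sum, ofRatClass_rat_smul']
  exact Submodule.sum_mem _ fun p _ ↦ Submodule.smul_mem _ _ (Submodule.subset_span ⟨p, rfl⟩)

/-- A `ℚ`-basis of `Hⁱ(Y;ℚ)`, pushed to `Hⁱ(Y;ℂ)`, is `ℂ`-linearly independent (the tree's `linearIndependent_of_isRationalClass`). [cite: VoisinHodgeI2002, §7.1.1] -/
theorem linearIndependent_ofRatClass_basis {ι : Type} [Fintype ι] {i : ℕ} (β : Module.Basis ι ℚ (bettiCohomology Y i)) :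
    LinearIndependent ℂ fun p ↦ ofRatClass (ComplexPoints Y) i (β p) := by
  refine linearIndependent_of_isRationalClass (fun p ↦ isRationalClass_ofRatClass _) fun q hq ↦ ?_
  have h1 : ofRatClass (ComplexPoints Y) i (∑ p, q p • β p) = 0 := by
    rw [map_sum]
    simpa only [ofRatClass_rat_smul'] using hq
  have h2 : ∑ p, q p • β p = 0 := ofRatClass_injective (Y := ComplexPoints Y) i (by rw [h1, map_zero])
  funext p
  exact Fintype.linearIndependent_iff.1 β.linearIndependent q h2 p

/-- **Every class of the piece `Hⁱ(Y) ⊗ Hʲ(Z)` is `Σ_p pr_Y^* b_p ∪ pr_Z^* w_p` over any family `b_p` spanning `Hⁱ(Y;ℂ)`** (bilinearity of the cross product). [cite: HatcherAT2002, §3.2 Thm. 3.15] -/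
theorem exists_eq_sum_cupProduct_fst_snd_of_mem_kunnethPiece {ι : Type} [Fintype ι] {c i j : ℕ} (hij : i + j = 2 * c) {b : ι → complexBetti Y i}
    (hb : ∀ y : complexBetti Y i, y ∈ Submodule.span ℂ (Set.range b)) {γ : complexBetti (Y ⊗ Z) (2 * c)} (hγ : γ ∈ kunnethPiece Y Z hij) :
    ∃ w : ι → complexBetti Z j, γ = ∑ p, cupProduct hij (complexBetti.map (fst Y Z) i (b p)) (complexBetti.map (snd Y Z) j (w p)) := by
  classical
  induction hγ using Submodule.span_induction with
  | mem x hx =>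
    obtain ⟨y, w, rfl⟩ := hx
    obtain ⟨cf, hcf⟩ := (Submodule.mem_span_range_iff_exists_fun ℂ).1 (hb y)
    refine ⟨fun p ↦ cf p • w, ?_⟩
    rw [← hcf]
    simp only [map_sum, map_smul, LinearMap.sum_apply, LinearMap.smul_apply]
  | zero => exact ⟨0, by simp⟩
  | add x x' _ _ hx hx' =>
    obtain ⟨w, rfl⟩ := hx
    obtain ⟨w', rfl⟩ := hx'
    refine ⟨w + w', ?_⟩
    simp only [Pi.add_apply, map_add, Finset.sum_add_distrib]
  | smul t x _ hx =>
    obtain ⟨w, rfl⟩ := hx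
    refine ⟨t • w, ?_⟩
    simp only [Pi.smul_apply, map_smul, Finset.smul_sum]

/-- **`corrAction μ` is injective on the Künneth piece `Hⁱ(Y) ⊗ Hʲ(Z)` as maps `Hᵃ(Z;ℂ) → Hⁱ(Y;ℂ)`, `a + j = 2 dim Z`** («`Hᵏ(X) ⊗ Hˡ(Y) ≅ Hom(H^{2n−k}(X), Hˡ(Y))` given by Poincaré duality»): a class
`γ ∈ kunnethPiece Y Z (i + j = 2c)` with `γ_* = 0` on `Hᵃ(Z;ℂ)` is zero.  Proof: write `γ = Σ_p pr_Y^* b_p ∪ pr_Z^* w_p` over the ℂ-basis `b_p = β_p ⊗ 1` induced by a ℚ-basis of `Hⁱ(Y;ℚ)`; by §1,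
`0 = γ_* u = Σ_p (−1)^{a i} λ_p(u) b_p` with `pr_{Y*} pr_Z^*(u ∪ w_p) = λ_p(u) · 1`; independence of the `b_p` gives `λ_p(u) = 0`, so `u ∪ w_p = 0` for all `u` (`pr_{Y*} pr_Z^*` kills no non-zero top class),
so `w_p = 0` (Poincaré duality). [cite: VoisinHodgeI2002, §11.3.3 Lemma 11.41 and p. 286] [cite: HatcherAT2002, §3.2 Thm. 3.15 and §3.3 Prop. 3.38] [cite: FultonYoungTableaux1997, Appendix B §B.1 (5)–(6)] -/
theorem corrAction_injOn_kunnethPiece (hY : IsSmoothProjective m Y) (hZ : IsSmoothProjective n Z) {c i j a : ℕ} (hij : i + j = 2 * c) (haj : a + j = 2 * n) (hab : a + 2 * c = i + 2 * n)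
    {γ : complexBetti (Y ⊗ Z) (2 * c)} (hγ : γ ∈ kunnethPiece Y Z hij) (h0 : corrAction μ hY hZ hab γ = 0) : γ = 0 := by
  classical
  haveI := BettiUniverse.finite hY i
  -- the ℂ-basis of `Hⁱ(Y;ℂ)` induced by a ℚ-basis of `Hⁱ(Y;ℚ)`
  let β := Module.finBasis ℚ (bettiCohomology Y i)
  let b : Fin (Module.finrank ℚ (bettiCohomology Y i)) → complexBetti Y i := fun p ↦ ofRatClass (ComplexPoints Y) i (β p)
  have hbind : LinearIndependent ℂ b := linearIndependent_ofRatClass_basis β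
  have hbspan : ∀ y : complexBetti Y i, y ∈ Submodule.span ℂ (Set.range b) := mem_span_range_ofRatClass_basis hY β
  obtain ⟨w, rfl⟩ := exists_eq_sum_cupProduct_fst_snd_of_mem_kunnethPiece hij hbspan hγ
  -- the scalars `λ(x)` with `pr_{Y*} pr_Z^* x = λ(x) · 1`
  have hG : ∀ x : complexBetti Z (2 * n), ∃ t : ℂ,
      complexGysin μ (hY.tensor_holds hZ) hY (fst Y Z) (show 2 * n + 2 * m = 0 + 2 * (m + n) by omega) (complexBetti.map (snd Y Z) (2 * n) x) =
        t • singularCohomology.one ℂ (ComplexPoints Y) := fun x ↦ exists_eq_smul_one μ hY _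
  choose lam hlam using hG
  -- every `w_p` vanishes
  have hw : ∀ p, w p = 0 := by
    intro p
    refine eq_zero_of_forall_cupProduct_eq_zero_right hZ haj fun u ↦ ?_
    refine eq_zero_of_complexGysin_fst_map_snd_eq_zero μ hY hZ ?_
    have hu := LinearMap.congr_fun h0 u
    rw [corrAction_sum_cupProduct_fst_snd_apply μ hY hZ hij haj hab b w u, LinearMap.zero_apply] at hu
    simp only [hlam, map_smul, cupProduct_one, smul_smul] at hu
    have hcoef := Fintype.linearIndependent_iff.1 hbind _ hu p
    have hl : lam (cupProduct haj u (w p)) = 0 := by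
      rcases mul_eq_zero.1 hcoef with h | h
      · exact absurd h (pow_ne_zero _ (neg_ne_zero.2 one_ne_zero))
      · exact h
    rw [hlam, hl, zero_smul]
  simp [hw]

/-- **Two classes of the same Künneth piece with the same action coincide.** [cite: VoisinHodgeI2002, §11.3.3 Lemma 11.41 and p. 286] -/
theorem eq_of_mem_kunnethPiece_of_corrAction_eq (hY : IsSmoothProjective m Y) (hZ : IsSmoothProjective n Z) {c i j a : ℕ} (hij : i + j = 2 * c) (haj : a + j = 2 * n)
    (hab : a + 2 * c = i + 2 * n) {γ γ' : complexBetti (Y ⊗ Z) (2 * c)} (hγ : γ ∈ kunnethPiece Y Z hij) (hγ' : γ' ∈ kunnethPiece Y Z hij)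
    (h : corrAction μ hY hZ hab γ = corrAction μ hY hZ hab γ') : γ = γ' := by
  rw [← sub_eq_zero]
  exact corrAction_injOn_kunnethPiece μ hY hZ hij haj hab (Submodule.sub_mem _ hγ hγ') (by rw [map_sub, h, sub_self])

end Injective

/-! ### §3 The `ℚ`-summand `Hⁱ(Y;ℚ) ⊗ Hʲ(Z;ℚ)` -/

section Summand

variable (μ : OrientationFamily)

/-- The cross product `crossMap : Hⁱ(Y;ℚ) ⊗ Hʲ(Z;ℚ) → Hᵏ(Y ⊗ Z;ℚ)` of ONE Künneth summand is injective (the Künneth map of the whole direct sum is bijective, Thm. 11.38; the tree's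
`BettiUniverse.kunnethMap_bijective`, `kunnethMap_single`). [cite: VoisinHodgeI2002, §11.3.3 Thm. 11.38] [cite: HatcherAT2002, §3.2 Thm. 3.15] -/
theorem BettiUniverse.crossMap_injective (hY : IsSmoothProjective m Y) (hZ : IsSmoothProjective n Z) {i j k : ℕ} (h : i + j = k) :
    Function.Injective (BettiUniverse.crossMap Y Z h) := by
  classical
  intro t t' htt
  have e : BettiUniverse.kunnethMap Y Z k (Pi.single (⟨(i, j), HasAntidiagonal.mem_antidiagonal.2 h⟩ : ↥(antidiagonal k)) t) =
      BettiUniverse.kunnethMap Y Z k (Pi.single (⟨(i, j), HasAntidiagonal.mem_antidiagonal.2 h⟩ : ↥(antidiagonal k)) t') := by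
    rw [BettiUniverse.kunnethMap_single, BettiUniverse.kunnethMap_single]
    exact htt
  have h2 := congr_fun ((BettiUniverse.kunnethMap_bijective hY hZ k).1 e) ⟨(i, j), HasAntidiagonal.mem_antidiagonal.2 h⟩
  simpa using h2

/-- **Kernel form on the `ℚ`-summand**: `t ∈ Hⁱ(Y;ℚ) ⊗ Hʲ(Z;ℚ)` with `(crossMap t ⊗ 1)_* = 0` on `Hᵃ(Z;ℂ)` (`a + j = 2 dim Z`) is zero (§2 on the complexification, then the injectivity of `⊗ 1` and of
`crossMap`). [cite: VoisinHodgeI2002, §11.3.3 Lemma 11.41 and p. 286] [cite: HatcherAT2002, §3.2 Thm. 3.15 and §3.3 Prop. 3.38] -/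
theorem BettiUniverse.eq_zero_of_corrAction_crossMap_eq_zero (hY : IsSmoothProjective m Y) (hZ : IsSmoothProjective n Z) {c i j a : ℕ} (hij : i + j = 2 * c) (haj : a + j = 2 * n)
    (hab : a + 2 * c = i + 2 * n) {t : bettiCohomology Y i ⊗[ℚ] bettiCohomology Z j}
    (h0 : corrAction μ hY hZ hab (ofRatClass (ComplexPoints (Y ⊗ Z)) (2 * c) (BettiUniverse.crossMap Y Z hij t)) = 0) : t = 0 := by
  have h1 : ofRatClass (ComplexPoints (Y ⊗ Z)) (2 * c) (BettiUniverse.crossMap Y Z hij t) = 0 :=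
    corrAction_injOn_kunnethPiece μ hY hZ hij haj hab (ofRatClass_crossMap_mem_kunnethPiece hij t) h0
  have h2 : BettiUniverse.crossMap Y Z hij t = 0 := ofRatClass_injective (Y := ComplexPoints (Y ⊗ Z)) (2 * c) (by rw [h1, map_zero])
  exact BettiUniverse.crossMap_injective hY hZ hij (by rw [h2, map_zero])

/-- **`t ↦ (crossMap t ⊗ 1)_*` is injective on `Hⁱ(Y;ℚ) ⊗ Hʲ(Z;ℚ)`** (as maps `Hᵃ(Z;ℂ) → Hⁱ(Y;ℂ)`, `a + j = 2 dim Z`): a rational correspondence of one Künneth summand is determined by its action.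
[cite: VoisinHodgeI2002, §11.3.3 Lemma 11.41 and p. 286] [cite: VoisinHodgeII2003, §10.2.2 proof of Thm. 10.17 (10.7)] -/
theorem BettiUniverse.corrAction_crossMap_injective (hY : IsSmoothProjective m Y) (hZ : IsSmoothProjective n Z) {c i j a : ℕ} (hij : i + j = 2 * c) (haj : a + j = 2 * n)
    (hab : a + 2 * c = i + 2 * n) :
    Function.Injective fun t : bettiCohomology Y i ⊗[ℚ] bettiCohomology Z j ↦ corrAction μ hY hZ hab (ofRatClass (ComplexPoints (Y ⊗ Z)) (2 * c) (BettiUniverse.crossMap Y Z hij t)) := by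
  intro t t' h
  rw [← sub_eq_zero]
  refine BettiUniverse.eq_zero_of_corrAction_crossMap_eq_zero μ hY hZ hij haj hab ?_
  have h' : corrAction μ hY hZ hab (ofRatClass (ComplexPoints (Y ⊗ Z)) (2 * c) (BettiUniverse.crossMap Y Z hij t)) =
      corrAction μ hY hZ hab (ofRatClass (ComplexPoints (Y ⊗ Z)) (2 * c) (BettiUniverse.crossMap Y Z hij t')) := h
  rw [map_sub, map_sub, map_sub, h', sub_self]

/-- **ℚ-linearly independent classes of `Hⁱ(Y;ℚ) ⊗ Hʲ(Z;ℚ)` act ℂ-linearly independently on `Hᵃ(Z;ℂ)`** (`a + j = 2 dim Z`): the rational classes `crossMap t_k ⊗ 1` are ℂ-independent (the tree's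
`linearIndependent_of_isRationalClass`) and a ℂ-combination of them lies in the Künneth piece, where the action is injective (§2). [cite: VoisinHodgeI2002, §7.1.1, §11.3.3 Lemma 11.41 and p. 286]
[cite: HatcherAT2002, §3.3 Prop. 3.38] -/
theorem BettiUniverse.linearIndependent_corrAction_crossMap {ι : Type} [Fintype ι] (hY : IsSmoothProjective m Y) (hZ : IsSmoothProjective n Z) {c i j a : ℕ} (hij : i + j = 2 * c)
    (haj : a + j = 2 * n) (hab : a + 2 * c = i + 2 * n) {t : ι → bettiCohomology Y i ⊗[ℚ] bettiCohomology Z j} (ht : LinearIndependent ℚ t) :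
    LinearIndependent ℂ fun k ↦ corrAction μ hY hZ hab (ofRatClass (ComplexPoints (Y ⊗ Z)) (2 * c) (BettiUniverse.crossMap Y Z hij (t k))) := by
  classical
  -- the rational classes `crossMap t_k ⊗ 1` are ℂ-linearly independent
  have hC : LinearIndependent ℂ fun k ↦ ofRatClass (ComplexPoints (Y ⊗ Z)) (2 * c) (BettiUniverse.crossMap Y Z hij (t k)) := by
    refine linearIndependent_of_isRationalClass (fun k ↦ isRationalClass_ofRatClass _) fun q hq ↦ ?_
    have h1 : ofRatClass (ComplexPoints (Y ⊗ Z)) (2 * c) (BettiUniverse.crossMap Y Z hij (∑ k, q k • t k)) = 0 := by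
      rw [map_sum, map_sum]
      simpa only [map_smul, ofRatClass_rat_smul'] using hq
    have h2 : ∑ k, q k • t k = 0 :=
      BettiUniverse.crossMap_injective hY hZ hij (ofRatClass_injective (Y := ComplexPoints (Y ⊗ Z)) (2 * c) (by rw [h1, map_zero, map_zero]))
    funext k
    exact Fintype.linearIndependent_iff.1 ht q h2 k
  rw [Fintype.linearIndependent_iff]
  intro g hg k
  -- `Σ g_k • (crossMap t_k ⊗ 1)` lies in the piece and acts by zero, hence vanishes
  have hmem : ∑ k, g k • ofRatClass (ComplexPoints (Y ⊗ Z)) (2 * c) (BettiUniverse.crossMap Y Z hij (t k)) ∈ kunnethPiece Y Z hij :=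
    Submodule.sum_mem _ fun k _ ↦ Submodule.smul_mem _ _ (ofRatClass_crossMap_mem_kunnethPiece hij (t k))
  have hact : corrAction μ hY hZ hab (∑ k, g k • ofRatClass (ComplexPoints (Y ⊗ Z)) (2 * c) (BettiUniverse.crossMap Y Z hij (t k))) = 0 := by
    rw [map_sum]
    simpa only [map_smul] using hg
  exact Fintype.linearIndependent_iff.1 hC g (corrAction_injOn_kunnethPiece μ hY hZ hij haj hab hmem hact) k

/-- **The bound `|ι| ≤ dim_ℚ Hdgᶜ(HⁱY ⊗ HʲZ)` of g30-#1 §2 is attained**: the cross products of a ℚ-basis of `Hdgᶜ(Hⁱ(Y) ⊗ Hʲ(Z))` are `dim_ℚ Hdgᶜ(HⁱY ⊗ HʲZ)` Hodge classes of `H^{2c}(Y ⊗ Z)` (any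
smooth-projective witness of the product) whose actions `Hᵃ(Z;ℂ) → Hⁱ(Y;ℂ)` are ℂ-linearly independent — «a Hodge class of `Hᵏ(X) ⊗ Hˡ(Y)` IS a morphism of Hodge structures».
[cite: VoisinHodgeI2002, §11.3.3 Thm. 11.40, Lemma 11.41 and p. 286] [cite: HatcherAT2002, §3.3 Prop. 3.38] -/
theorem BettiUniverse.exists_hodgeClasses_linearIndependent_corrAction [HodgeTensorFacts.{0, 0}] (hHD : exists_isReal_hodgeModel) (hY : IsSmoothProjective m Y) (hZ : IsSmoothProjective n Z)
    (hYZ : IsSmoothProjective d (Y ⊗ Z)) {c i j a : ℕ} (hij : i + j = 2 * c) (haj : a + j = 2 * n) (hab : a + 2 * c = i + 2 * n) :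
    ∃ v : Fin (Module.finrank ℚ ↥(((BettiUniverse.hodge hHD hY i).tensor (BettiUniverse.hodge hHD hZ j)).hodgeClasses c)) → bettiCohomology (Y ⊗ Z) (2 * c),
      (∀ k, v k ∈ (BettiUniverse.hodge hHD hYZ (2 * c)).hodgeClasses c) ∧
      (∀ k, ofRatClass (ComplexPoints (Y ⊗ Z)) (2 * c) (v k) ∈ kunnethPiece Y Z hij) ∧
      LinearIndependent ℂ fun k ↦ corrAction μ hY hZ hab (ofRatClass (ComplexPoints (Y ⊗ Z)) (2 * c) (v k)) := by
  classical
  haveI := BettiUniverse.finite hY i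
  haveI := BettiUniverse.finite hZ j
  let H : Submodule ℚ (bettiCohomology Y i ⊗[ℚ] bettiCohomology Z j) := ((BettiUniverse.hodge hHD hY i).tensor (BettiUniverse.hodge hHD hZ j)).hodgeClasses (c : ℤ)
  let β := Module.finBasis ℚ ↥H
  refine ⟨fun k ↦ BettiUniverse.crossMap Y Z hij (β k : bettiCohomology Y i ⊗[ℚ] bettiCohomology Z j), fun k ↦ ?_, fun k ↦ ofRatClass_crossMap_mem_kunnethPiece hij _, ?_⟩
  · exact BettiUniverse.crossMap_mem_hodgeClasses hHD hodgePQ_independent_of_hodgeModel_holds hY hZ hYZ hij c (β k).2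
  · have hli : LinearIndependent ℚ fun k ↦ ((β k : ↥H) : bettiCohomology Y i ⊗[ℚ] bettiCohomology Z j) :=
      (β.linearIndependent.map' H.subtype (Submodule.ker_subtype H))
    exact BettiUniverse.linearIndependent_corrAction_crossMap μ hY hZ hij haj hab hli

end Summand

end Literature.AlgebraicGeometry.HodgeTheory

end
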